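import Summits.ValiantsHypothesis.ValiantsHypothesis.Theses.PolyaContinued

/-!
# Birth skeleton (BC3) for the piece `CoverDecancellation` (item stmt-ValiantsHypothesis-17819, rank 3;
split child of `PfaffianCoverHard`, route PolyaContinued)

`CoverDecancellation`: there is `c` such that for all `n, m`, every Pfaffian cover of `per_n` of size `m`
with COMPLEX constants converts into a `0/1` (label-bijective) Pfaffian cover of size `≤ 2^((log₂ m + c)^c)`.
The line factors the decancellation through the UNIT-CONSTANT normal form:

* `stub_unitConstants` (FIELD CONSTANTS REDUCE TO SIGNS, size M–L): a Pfaffian cover of `per_n` with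
  complex constants converts at quasi-polynomial cost into one whose projection uses only the constants
  `0, 1, -1`. Why plausible: `per_n` has integer coefficients; `ℂ → ℝ` is routine (real/imaginary parts as
  a width-2 simulation through ABPs and `PfaffianNormalForm`); `ℝ → ℚ̄ ∩ ℝ` by transfer (the cover condition
  is a first-order sentence with integer parameters); integers/rationals in binary through doubling gadgets
  (`2 = 1 + 1` as two parallel free paths). The open part is the HEIGHT: clearing algebraic constants of
  large degree / rationals with large denominators at quasi-polynomial cost (constant-elimination in the
  sense of Bürgisser Ch. 4 / Koiran's `VP⁰`). Why it might fail: optimal covers of `per_n` might need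
  constants of exponential height or degree (no example known; every known cover is `0/1`).
* `stub_signElimination` (PÓLYA'S PROBLEM, CONTINUED — SIGNS BUY AT MOST qp, size L; the heart): a
  Pfaffian cover of `per_n` whose projection uses only `0, ±1` converts at quasi-polynomial cost into a
  `0/1` cover. Pólya/Marcus–Minc/Botta: at size `m = n` signs buy nothing (no sign conversion of the
  permanent, `n ≥ 3`); Grenet's `2^n − 1` cover is sign-free; the claim interpolates. Why it might fail: a
  `±1`-weighted Pfaffian construction of size `2^(n^o(1))` for `per_n` (compressed inclusion–exclusion)
  while bijective covers stay `2^Ω(n)`; nothing is known either way beyond `n = 3` (dc(per_3) = 7 = Grenet,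
  Alper–Bogart–Velasco 2017).

`CoverDecancellation_of` composes the two (qp ∘ qp = qp, `decancellation_exponent_le`) and concludes the
piece `CoverDecancellation` BY NAME. BC3 probes for the
stubs (each against the piece, the parent crux and the summit) are recorded in the strategist NOTES.
-/

set_option linter.dupNamespace false

namespace Summit.ValiantsHypothesis.ValiantsHypothesis.Cruxes.PfaffianCoverHard.BirthCoverDecancellation

open Literature.Computability.AlgebraicComplexity
open Summit.ValiantsHypothesis.ValiantsHypothesis.Theses.PolyaContinued

/-- STUB A — field constants reduce to signs at quasi-polynomial cost (for covers of the permanent). -/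
theorem stub_unitConstants :
    ∃ c : ℕ, ∀ n m : ℕ,
      (∃ (E : Finset (Fin m × Fin m)) (P : MvPolynomial (Fin m × Fin m) ℂ),
        P = (Matrix.of fun i j => if (i, j) ∈ E then MvPolynomial.X (i, j) else 0 :
              Matrix (Fin m) (Fin m) (MvPolynomial (Fin m × Fin m) ℂ)).permanent ∧
        (∃ s : Fin m × Fin m → ℂ, (∀ e, s e = 1 ∨ s e = -1) ∧
          (Matrix.of fun i j => if (i, j) ∈ E then MvPolynomial.C (s (i, j)) * MvPolynomial.X (i, j)
              else 0 : Matrix (Fin m) (Fin m) (MvPolynomial (Fin m × Fin m) ℂ)).det = P) ∧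
        Literature.Computability.AlgebraicComplexity.IsProjection
          (Literature.Computability.AlgebraicComplexity.perPoly (Fin n) ℂ) P) →
      ∃ m₁ : ℕ, m₁ ≤ 2 ^ ((Nat.log 2 m + c) ^ c) ∧
      (∃ (E₁ : Finset (Fin m₁ × Fin m₁)) (P₁ : MvPolynomial (Fin m₁ × Fin m₁) ℂ),
        P₁ = (Matrix.of fun i j => if (i, j) ∈ E₁ then MvPolynomial.X (i, j) else 0 :
              Matrix (Fin m₁) (Fin m₁) (MvPolynomial (Fin m₁ × Fin m₁) ℂ)).permanent ∧
        (∃ s₁ : Fin m₁ × Fin m₁ → ℂ, (∀ e, s₁ e = 1 ∨ s₁ e = -1) ∧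
          (Matrix.of fun i j => if (i, j) ∈ E₁ then MvPolynomial.C (s₁ (i, j)) * MvPolynomial.X (i, j)
              else 0 : Matrix (Fin m₁) (Fin m₁) (MvPolynomial (Fin m₁ × Fin m₁) ℂ)).det = P₁) ∧
        ∃ a : Fin m₁ × Fin m₁ → MvPolynomial (Fin n × Fin n) ℂ,
          (∀ e, (∃ j, a e = MvPolynomial.X j) ∨ a e = 0 ∨ a e = 1 ∨ a e = -1) ∧
          Literature.Computability.AlgebraicComplexity.perPoly (Fin n) ℂ = MvPolynomial.aeval a P₁) := by
  sorry

/-- STUB B — Pólya continued: signs buy at most a quasi-polynomial saving (for covers of the permanent). -/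
theorem stub_signElimination :
    ∃ c : ℕ, ∀ n m₁ : ℕ,
      (∃ (E₁ : Finset (Fin m₁ × Fin m₁)) (P₁ : MvPolynomial (Fin m₁ × Fin m₁) ℂ),
        P₁ = (Matrix.of fun i j => if (i, j) ∈ E₁ then MvPolynomial.X (i, j) else 0 :
              Matrix (Fin m₁) (Fin m₁) (MvPolynomial (Fin m₁ × Fin m₁) ℂ)).permanent ∧
        (∃ s₁ : Fin m₁ × Fin m₁ → ℂ, (∀ e, s₁ e = 1 ∨ s₁ e = -1) ∧
          (Matrix.of fun i j => if (i, j) ∈ E₁ then MvPolynomial.C (s₁ (i, j)) * MvPolynomial.X (i, j)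
              else 0 : Matrix (Fin m₁) (Fin m₁) (MvPolynomial (Fin m₁ × Fin m₁) ℂ)).det = P₁) ∧
        ∃ a : Fin m₁ × Fin m₁ → MvPolynomial (Fin n × Fin n) ℂ,
          (∀ e, (∃ j, a e = MvPolynomial.X j) ∨ a e = 0 ∨ a e = 1 ∨ a e = -1) ∧
          Literature.Computability.AlgebraicComplexity.perPoly (Fin n) ℂ = MvPolynomial.aeval a P₁) →
      ∃ m' : ℕ, m' ≤ 2 ^ ((Nat.log 2 m₁ + c) ^ c) ∧
      (∃ (E' : Finset (Fin m' × Fin m')) (P' : MvPolynomial (Fin m' × Fin m') ℂ),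
        P' = (Matrix.of fun i j => if (i, j) ∈ E' then MvPolynomial.X (i, j) else 0 :
              Matrix (Fin m') (Fin m') (MvPolynomial (Fin m' × Fin m') ℂ)).permanent ∧
        (∃ s' : Fin m' × Fin m' → ℂ, (∀ e, s' e = 1 ∨ s' e = -1) ∧
          (Matrix.of fun i j => if (i, j) ∈ E' then MvPolynomial.C (s' (i, j)) * MvPolynomial.X (i, j)
              else 0 : Matrix (Fin m') (Fin m') (MvPolynomial (Fin m' × Fin m') ℂ)).det = P') ∧
        ∃ a : Fin m' × Fin m' → MvPolynomial (Fin n × Fin n) ℂ,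
          (∀ e, (∃ j, a e = MvPolynomial.X j) ∨ a e = 0 ∨ a e = 1) ∧
          Literature.Computability.AlgebraicComplexity.perPoly (Fin n) ℂ = MvPolynomial.aeval a P') := by
  sorry

/-- Exponent bookkeeping (`qp ∘ qp = qp`): if `m ≤ 2^((L + c₀)^c₀)` then
`(Nat.log 2 m + c)^c ≤ (L + K)^K` with `K = (c₀ + 2) * c + c₀ + c + 2`. -/
theorem decancellation_exponent_le (L c₀ c m : ℕ) (hm : m ≤ 2 ^ ((L + c₀) ^ c₀)) :
    (Nat.log 2 m + c) ^ c ≤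
      (L + ((c₀ + 2) * c + c₀ + c + 2)) ^ ((c₀ + 2) * c + c₀ + c + 2) := by
  set A := (L + c₀) ^ c₀ with hA
  set K := (c₀ + 2) * c + c₀ + c + 2 with hK
  have hlog : Nat.log 2 m ≤ A := by
    calc Nat.log 2 m ≤ Nat.log 2 (2 ^ A) := Nat.log_mono_right hm
      _ = A := Nat.log_pow Nat.one_lt_two _
  set D := L + c₀ + c + 2 with hD
  have hD2 : 2 ≤ D := by omega
  have hD1 : 1 ≤ D := by omega
  have hAD : A ≤ D ^ (c₀ + 1) := by
    calc A = (L + c₀) ^ c₀ := hA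
      _ ≤ D ^ c₀ := Nat.pow_le_pow_left (by omega) c₀
      _ ≤ D ^ c₀ * D := Nat.le_mul_of_pos_right _ (by omega)
      _ = D ^ (c₀ + 1) := (pow_succ D c₀).symm
  have hcD : c ≤ D ^ (c₀ + 1) := by
    calc c ≤ D := by omega
      _ ≤ D ^ (c₀ + 1) := Nat.le_self_pow (by omega) D
  have hbase : Nat.log 2 m + c ≤ D ^ (c₀ + 2) := by
    calc Nat.log 2 m + c ≤ D ^ (c₀ + 1) + D ^ (c₀ + 1) := Nat.add_le_add (le_trans hlog hAD) hcD
      _ = 2 * D ^ (c₀ + 1) := (two_mul _).symm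
      _ ≤ D * D ^ (c₀ + 1) := Nat.mul_le_mul_right _ hD2
      _ = D ^ (c₀ + 2) := by rw [mul_comm, ← pow_succ]
  have hDK : D ≤ L + K := by
    have : c₀ + c + 2 ≤ K := by rw [hK]; omega
    omega
  have hLK : 1 ≤ L + K := le_trans hD1 hDK
  calc (Nat.log 2 m + c) ^ c ≤ (D ^ (c₀ + 2)) ^ c := Nat.pow_le_pow_left hbase c
    _ = D ^ ((c₀ + 2) * c) := by rw [← pow_mul]
    _ ≤ (L + K) ^ ((c₀ + 2) * c) := Nat.pow_le_pow_left hDK _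
    _ ≤ (L + K) ^ K := Nat.pow_le_pow_right hLK (by rw [hK]; omega)

/-- COMPOSITION: stub A (exponent `c₁`) then stub B (exponent `c₂`) gives decancellation with exponent
`K = (c₁ + 2)c₂ + c₁ + c₂ + 2`. -/
theorem coverDecancellation_of_stubs
    (hA : ∃ c : ℕ, ∀ n m : ℕ,
      (∃ (E : Finset (Fin m × Fin m)) (P : MvPolynomial (Fin m × Fin m) ℂ),
        P = (Matrix.of fun i j => if (i, j) ∈ E then MvPolynomial.X (i, j) else 0 :
              Matrix (Fin m) (Fin m) (MvPolynomial (Fin m × Fin m) ℂ)).permanent ∧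
        (∃ s : Fin m × Fin m → ℂ, (∀ e, s e = 1 ∨ s e = -1) ∧
          (Matrix.of fun i j => if (i, j) ∈ E then MvPolynomial.C (s (i, j)) * MvPolynomial.X (i, j)
              else 0 : Matrix (Fin m) (Fin m) (MvPolynomial (Fin m × Fin m) ℂ)).det = P) ∧
        Literature.Computability.AlgebraicComplexity.IsProjection
          (Literature.Computability.AlgebraicComplexity.perPoly (Fin n) ℂ) P) →
      ∃ m₁ : ℕ, m₁ ≤ 2 ^ ((Nat.log 2 m + c) ^ c) ∧
      (∃ (E₁ : Finset (Fin m₁ × Fin m₁)) (P₁ : MvPolynomial (Fin m₁ × Fin m₁) ℂ),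
        P₁ = (Matrix.of fun i j => if (i, j) ∈ E₁ then MvPolynomial.X (i, j) else 0 :
              Matrix (Fin m₁) (Fin m₁) (MvPolynomial (Fin m₁ × Fin m₁) ℂ)).permanent ∧
        (∃ s₁ : Fin m₁ × Fin m₁ → ℂ, (∀ e, s₁ e = 1 ∨ s₁ e = -1) ∧
          (Matrix.of fun i j => if (i, j) ∈ E₁ then MvPolynomial.C (s₁ (i, j)) * MvPolynomial.X (i, j)
              else 0 : Matrix (Fin m₁) (Fin m₁) (MvPolynomial (Fin m₁ × Fin m₁) ℂ)).det = P₁) ∧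
        ∃ a : Fin m₁ × Fin m₁ → MvPolynomial (Fin n × Fin n) ℂ,
          (∀ e, (∃ j, a e = MvPolynomial.X j) ∨ a e = 0 ∨ a e = 1 ∨ a e = -1) ∧
          Literature.Computability.AlgebraicComplexity.perPoly (Fin n) ℂ = MvPolynomial.aeval a P₁))
    (hB : ∃ c : ℕ, ∀ n m₁ : ℕ,
      (∃ (E₁ : Finset (Fin m₁ × Fin m₁)) (P₁ : MvPolynomial (Fin m₁ × Fin m₁) ℂ),
        P₁ = (Matrix.of fun i j => if (i, j) ∈ E₁ then MvPolynomial.X (i, j) else 0 :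
              Matrix (Fin m₁) (Fin m₁) (MvPolynomial (Fin m₁ × Fin m₁) ℂ)).permanent ∧
        (∃ s₁ : Fin m₁ × Fin m₁ → ℂ, (∀ e, s₁ e = 1 ∨ s₁ e = -1) ∧
          (Matrix.of fun i j => if (i, j) ∈ E₁ then MvPolynomial.C (s₁ (i, j)) * MvPolynomial.X (i, j)
              else 0 : Matrix (Fin m₁) (Fin m₁) (MvPolynomial (Fin m₁ × Fin m₁) ℂ)).det = P₁) ∧
        ∃ a : Fin m₁ × Fin m₁ → MvPolynomial (Fin n × Fin n) ℂ,
          (∀ e, (∃ j, a e = MvPolynomial.X j) ∨ a e = 0 ∨ a e = 1 ∨ a e = -1) ∧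
          Literature.Computability.AlgebraicComplexity.perPoly (Fin n) ℂ = MvPolynomial.aeval a P₁) →
      ∃ m' : ℕ, m' ≤ 2 ^ ((Nat.log 2 m₁ + c) ^ c) ∧
      (∃ (E' : Finset (Fin m' × Fin m')) (P' : MvPolynomial (Fin m' × Fin m') ℂ),
        P' = (Matrix.of fun i j => if (i, j) ∈ E' then MvPolynomial.X (i, j) else 0 :
              Matrix (Fin m') (Fin m') (MvPolynomial (Fin m' × Fin m') ℂ)).permanent ∧
        (∃ s' : Fin m' × Fin m' → ℂ, (∀ e, s' e = 1 ∨ s' e = -1) ∧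
          (Matrix.of fun i j => if (i, j) ∈ E' then MvPolynomial.C (s' (i, j)) * MvPolynomial.X (i, j)
              else 0 : Matrix (Fin m') (Fin m') (MvPolynomial (Fin m' × Fin m') ℂ)).det = P') ∧
        ∃ a : Fin m' × Fin m' → MvPolynomial (Fin n × Fin n) ℂ,
          (∀ e, (∃ j, a e = MvPolynomial.X j) ∨ a e = 0 ∨ a e = 1) ∧
          Literature.Computability.AlgebraicComplexity.perPoly (Fin n) ℂ = MvPolynomial.aeval a P')) :
    ∃ c : ℕ, ∀ n m : ℕ,
    (∃ (E : Finset (Fin m × Fin m)) (P : MvPolynomial (Fin m × Fin m) ℂ),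
      P = (Matrix.of fun i j => if (i, j) ∈ E then MvPolynomial.X (i, j) else 0 :
            Matrix (Fin m) (Fin m) (MvPolynomial (Fin m × Fin m) ℂ)).permanent ∧
      (∃ s : Fin m × Fin m → ℂ, (∀ e, s e = 1 ∨ s e = -1) ∧
        (Matrix.of fun i j => if (i, j) ∈ E then MvPolynomial.C (s (i, j)) * MvPolynomial.X (i, j)
            else 0 : Matrix (Fin m) (Fin m) (MvPolynomial (Fin m × Fin m) ℂ)).det = P) ∧
      Literature.Computability.AlgebraicComplexity.IsProjection
        (Literature.Computability.AlgebraicComplexity.perPoly (Fin n) ℂ) P) →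
    ∃ m' : ℕ, m' ≤ 2 ^ ((Nat.log 2 m + c) ^ c) ∧
      ∃ (E' : Finset (Fin m' × Fin m')) (P' : MvPolynomial (Fin m' × Fin m') ℂ),
        P' = (Matrix.of fun i j => if (i, j) ∈ E' then MvPolynomial.X (i, j) else 0 :
              Matrix (Fin m') (Fin m') (MvPolynomial (Fin m' × Fin m') ℂ)).permanent ∧
        (∃ s' : Fin m' × Fin m' → ℂ, (∀ e, s' e = 1 ∨ s' e = -1) ∧
          (Matrix.of fun i j => if (i, j) ∈ E' then MvPolynomial.C (s' (i, j)) * MvPolynomial.X (i, j)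
              else 0 : Matrix (Fin m') (Fin m') (MvPolynomial (Fin m' × Fin m') ℂ)).det = P') ∧
        ∃ a : Fin m' × Fin m' → MvPolynomial (Fin n × Fin n) ℂ,
          (∀ e, (∃ j, a e = MvPolynomial.X j) ∨ a e = 0 ∨ a e = 1) ∧
          Literature.Computability.AlgebraicComplexity.perPoly (Fin n) ℂ = MvPolynomial.aeval a P' := by
  obtain ⟨c₁, hc₁⟩ := hA
  obtain ⟨c₂, hc₂⟩ := hB
  refine ⟨(c₁ + 2) * c₂ + c₁ + c₂ + 2, fun n m hcov => ?_⟩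
  obtain ⟨m₁, hm₁, E₁, P₁, hP₁, hs₁, a₁, ha₁, hper₁⟩ := hc₁ n m hcov
  obtain ⟨m', hm', E', P', hP', hs', a, ha, hper⟩ := hc₂ n m₁ ⟨E₁, P₁, hP₁, hs₁, a₁, ha₁, hper₁⟩
  exact ⟨m', le_trans hm' (Nat.pow_le_pow_right Nat.two_pos
    (decancellation_exponent_le (Nat.log 2 m) c₁ c₂ m₁ hm₁)), E', P', hP', hs', a, ha, hper⟩

/-- THE PIECE `CoverDecancellation` BY NAME from the two declared stubs (the route decl unfolds to the
statement concluded by `coverDecancellation_of_stubs`). -/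
theorem CoverDecancellation_of : CoverDecancellation :=
  coverDecancellation_of_stubs stub_unitConstants stub_signElimination

end Summit.ValiantsHypothesis.ValiantsHypothesis.Cruxes.PfaffianCoverHard.BirthCoverDecancellation
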